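import Summits.RiemannHypothesis.RiemannHypothesis.Theorems.SemilocalSoninLimitBridge
import HarnessLib

/-!
# The semilocal operator obligation: the Weil side along mollifications of a bounded witness (`S = {∞, 2}`)

Cell `rh-explicit`, seat cc-s2-1 (HOME `run/shared/lean/pub/rh-explicit/`; lead ruling R5-1, PHASE 2 inputs: the last
analytic piece — E5's limit — so that the assembly of `¬ SemilocalSoninIneqOn 2 a` from the archived certificates is
arithmetic on closed-form data).

For a bounded measurable `G` vanishing off `[−b, b]` (NO parity assumption) and its mollifications `g_k = G ⋆ φ_k`:

* `weilIncrement_weilConv_moll_le_of_bdd` — `D_t(g_k) ≤ D_t(G)` for every `t` (the tree's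
  `IsMarkovWitness.weilIncrement_weilConv_moll_le`, seat lad-2 / cc-s2-2, with the oddness field of `IsMarkovWitness`
  dropped: the proof never used it);
* `tendsto_integral_norm_sq_weilConv_moll_of_bdd` — `‖g_k‖₂² → ‖G‖₂²` when `G` is continuous a.e.;
* `re_semilocalSide_two_eq` — **the operator statement's right-hand side in jump form**: for a Weil test `g` on
  `[−a, a]`, `a ≤ log 2`, `Re(W_∞(k) − W_2(k)) = (log 2/√2)·D_{log 2}(g) + ∫₀^∞ w D(g) − C₂‖g‖₂²`, `k = g ⋆ g̃` — the
  polar term is ABSENT (it is `Re Q_{{2}}(g) − P(g)` of the tree's `re_weilSemilocalQuadratic_two_eq`), so CC's moment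
  conditions play no rôle on this side;
* `eventually_re_semilocalSide_two_moll_le` — if `∫₀^∞ w D(G) < ∞`, `b < log 2` and
  `(log 2/√2)D_{log 2}(G) + ∫₀^∞ w D(G) − C₂‖G‖₂² < C`, then `Re(W_∞ − W_2)(g_k ⋆ g̃_k) ≤ C` for all large `k`;
* **`not_semilocalSoninIneqOn_two_of_bdd_witness`** — the bridge of `SemilocalSoninLimitBridge` with its Weil-side
  hypothesis `hC` replaced by these closed-form data: the FINAL shape the certificate assembly (seat cc-s2-3, E8)
  discharges: `(ε, d, B, Gm, N, K, D_{log 2}(G), ∫ w D(G), ‖G‖₂²)` and one strict inequality.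

Proof-only file (no definitions, no named facts). [folklore]
-/

set_option linter.dupNamespace false  -- the mandated namespace repeats `RiemannHypothesis`

noncomputable section

open MeasureTheory Complex Set Filter Topology FourierTransform
open scoped Real ComplexConjugate Convolution ENNReal

namespace Summit.RiemannHypothesis.RiemannHypothesis

open Literature.NumberTheory.LFunctions Literature.NumberTheory.LFunctions.WeilContinuous
  Literature.NumberTheory.ConnesConsani2021
  Summit.RiemannHypothesis.RiemannHypothesis.Theorems.MotivicDoor.SemilocalMarkov

section BoundedWitnessWeil

variable {G : ℝ → ℂ} {b M : ℝ}

/-! ## The increment contracts under mollification (no parity) -/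

/-- `‖G(u+t) − G(u)‖ ≤ 2M`. [folklore] -/
theorem norm_shift_sub_le_of_bdd (hM : ∀ x, ‖G x‖ ≤ M) (t u : ℝ) : ‖G (u + t) - G u‖ ≤ 2 * M :=
  (norm_sub_le _ _).trans (by linarith [hM (u + t), hM u])

/-- The shifted difference vanishes off `[−(b + |t|), b + |t|]`. [folklore] -/
theorem shift_sub_eq_zero_of_bdd (hGb : ∀ x, b < |x| → G x = 0) {t u : ℝ} (hu : b + |t| < |u|) :
    G (u + t) - G u = 0 := by
  have h1 : b < |u| := by linarith [abs_nonneg t]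
  have h2 : b < |u + t| := by
    have := abs_add_le (u + t) (-t)
    rw [add_neg_cancel_right, abs_neg] at this
    linarith
  rw [hGb _ h1, hGb _ h2, sub_zero]

/-- `‖G(· + t) − G‖²` is integrable. [folklore] -/
theorem integrable_norm_shift_sub_sq_of_bdd (hGm : Measurable G) (hM : ∀ x, ‖G x‖ ≤ M)
    (hGb : ∀ x, b < |x| → G x = 0) (t : ℝ) : Integrable fun u ↦ ‖G (u + t) - G u‖ ^ 2 := by
  refine integrable_of_norm_le_of_eq_zero (C := (2 * M) ^ 2) (R := b + |t|) ?_ (fun u ↦ ?_) (fun u hu ↦ ?_)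
  · exact (((hGm.comp (measurable_id.add_const t)).sub hGm).norm.pow_const 2).aestronglyMeasurable
  · rw [Real.norm_eq_abs, abs_of_nonneg (by positivity)]
    exact pow_le_pow_left₀ (norm_nonneg _) (norm_shift_sub_le_of_bdd hM t u) 2
  · rw [shift_sub_eq_zero_of_bdd hGb hu, norm_zero, zero_pow two_ne_zero]

/-- `‖G‖²` is integrable. [folklore] -/
theorem integrable_norm_sq_of_bdd (hGm : Measurable G) (hM : ∀ x, ‖G x‖ ≤ M)
    (hGb : ∀ x, b < |x| → G x = 0) : Integrable fun x ↦ ‖G x‖ ^ 2 := by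
  refine integrable_of_norm_le_of_eq_zero (C := M ^ 2) (R := b)
    (hGm.norm.pow_const 2).aestronglyMeasurable (fun x ↦ ?_) (fun x hx ↦ ?_)
  · rw [Real.norm_eq_abs, abs_of_nonneg (by positivity)]
    exact pow_le_pow_left₀ (norm_nonneg _) (hM x) 2
  · rw [hGb x hx, norm_zero, zero_pow two_ne_zero]

/-- `g_k(x + t) − g_k(x) = ∫ (G(u + t) − G(u)) φ_k(x − u) du`. [folklore] -/
theorem weilConv_moll_add_sub_of_bdd (hGm : Measurable G) (hM : ∀ x, ‖G x‖ ≤ M) (k : ℕ) (x t : ℝ) :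
    weilConv G (moll k) (x + t) - weilConv G (moll k) x = ∫ u, (G (u + t) - G u) * moll k (x - u) := by
  simp only [weilConv_apply]
  rw [← integral_add_right_eq_self (fun u ↦ G u * moll k (x + t - u)) t]
  simp only [show ∀ u : ℝ, x + t - (u + t) = x - u from fun u ↦ by ring]
  rw [← integral_sub (IsMarkovWitness.integrable_mul_moll (F := fun u ↦ G (u + t))
      (hGm.comp (measurable_id.add_const t)) (fun u ↦ hM (u + t)) k x)
      (IsMarkovWitness.integrable_mul_moll hGm hM k x)]
  congr 1 with u
  ring

/-- `|g_k(x+t) − g_k(x)|² ≤ ∫ |G(u+t) − G(u)|² |φ_k(x − u)| du`. [folklore] -/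
theorem norm_sq_weilConv_moll_sub_le_of_bdd (hGm : Measurable G) (hM : ∀ x, ‖G x‖ ≤ M) (k : ℕ) (x t : ℝ) :
    ‖weilConv G (moll k) (x + t) - weilConv G (moll k) x‖ ^ 2 ≤
      ∫ u, ‖G (u + t) - G u‖ ^ 2 * ‖moll k (x - u)‖ := by
  rw [weilConv_moll_add_sub_of_bdd hGm hM]
  have hmeas : Measurable fun u ↦ G (u + t) - G u := (hGm.comp (measurable_id.add_const t)).sub hGm
  have h3 : Integrable fun u ↦ ‖moll k (x - u)‖ := (integrable_norm_moll k).comp_sub_left x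
  refine IsMarkovWitness.norm_sq_integral_mul_le
    (IsMarkovWitness.integrable_mul_moll hmeas (norm_shift_sub_le_of_bdd hM t) k x) ?_ h3 ?_
  · exact h3.bdd_mul (c := (2 * M) ^ 2) ((hmeas.norm.pow_const 2).aestronglyMeasurable)
      (Eventually.of_forall fun u ↦ by
        rw [Real.norm_eq_abs, abs_of_nonneg (by positivity)]
        exact pow_le_pow_left₀ (norm_nonneg _) (norm_shift_sub_le_of_bdd hM t u) 2)
  · rw [integral_sub_left_eq_self (fun u ↦ ‖moll k u‖) volume x, integral_norm_moll]

/-- **`D_t(G ⋆ φ_k) ≤ D_t(G)`** for every `t`, for a bounded measurable `G` vanishing off `[−b, b]` (no parity).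
[folklore] -/
theorem weilIncrement_weilConv_moll_le_of_bdd (hGm : Measurable G) (hM : ∀ x, ‖G x‖ ≤ M)
    (hGb : ∀ x, b < |x| → G x = 0) (k : ℕ) (t : ℝ) :
    weilIncrement (weilConv G (moll k)) t ≤ weilIncrement G t := by
  have hg := isWeilTest_weilConv_moll_of_bdd hGm hM hGb k
  have hi1 : Integrable fun x ↦ ‖weilConv G (moll k) (x + t) - weilConv G (moll k) x‖ ^ 2 :=
    integrable_weilIncrement_integrand hg.memLp_two t
  have hF : Integrable fun u ↦ ‖G (u + t) - G u‖ ^ 2 := integrable_norm_shift_sub_sq_of_bdd hGm hM hGb t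
  have hi2 : Integrable ((fun u ↦ ‖G (u + t) - G u‖ ^ 2) ⋆[ContinuousLinearMap.mul ℝ ℝ, volume]
      (fun y ↦ ‖moll k y‖)) :=
    hF.integrable_convolution _ (integrable_norm_moll k)
  have hle : ∀ x, ‖weilConv G (moll k) (x + t) - weilConv G (moll k) x‖ ^ 2 ≤
      ((fun u ↦ ‖G (u + t) - G u‖ ^ 2) ⋆[ContinuousLinearMap.mul ℝ ℝ, volume] (fun y ↦ ‖moll k y‖)) x := by
    intro x
    rw [convolution_mul]
    exact norm_sq_weilConv_moll_sub_le_of_bdd hGm hM k x t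
  unfold weilIncrement
  refine (integral_mono hi1 hi2 hle).trans_eq ?_
  rw [integral_convolution _ hF (integrable_norm_moll k), integral_norm_moll]
  simp

/-- **`‖g_k‖₂² → ‖G‖₂²`** for a bounded measurable `G` vanishing off `[−b, b]`, continuous a.e. [folklore] -/
theorem tendsto_integral_norm_sq_weilConv_moll_of_bdd (hGm : Measurable G) (hM : ∀ x, ‖G x‖ ≤ M)
    (hGb : ∀ x, b < |x| → G x = 0) (hGc : ∀ᵐ x : ℝ, ContinuousAt G x) :
    Tendsto (fun k : ℕ ↦ ∫ x, ‖weilConv G (moll k) x‖ ^ 2) atTop (𝓝 (∫ x, ‖G x‖ ^ 2)) := by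
  have hdom : Integrable ((Icc (-(b + 1)) (b + 1)).indicator fun _ : ℝ ↦ (M ^ 2 : ℝ)) :=
    (continuous_const.integrableOn_Icc).integrable_indicator measurableSet_Icc
  refine tendsto_integral_of_dominated_convergence
    ((Icc (-(b + 1)) (b + 1)).indicator fun _ : ℝ ↦ (M ^ 2 : ℝ))
    (fun k ↦ ((isWeilTest_weilConv_moll_of_bdd hGm hM hGb k).1.continuous.norm.pow 2).aestronglyMeasurable)
    hdom (fun k ↦ Eventually.of_forall fun x ↦ ?_)
    (hGc.mono fun x hx ↦
      ((IsMarkovWitness.tendsto_weilConv_moll_of_continuousAt hGm hM hx).norm.pow 2))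
  rw [Real.norm_eq_abs, abs_of_nonneg (by positivity)]
  by_cases hx : x ∈ Icc (-(b + 1)) (b + 1)
  · rw [indicator_of_mem hx]
    exact pow_le_pow_left₀ (norm_nonneg _) (norm_weilConv_moll_le_of_bdd hM k x) 2
  · rw [indicator_of_notMem hx, weilConv_moll_eq_zero_of_bdd_of_lt hGb (lt_abs_of_not_mem_Icc hx), norm_zero,
      zero_pow two_ne_zero]

/-! ## The operator statement's right-hand side in jump form (`S = {∞, 2}`, window `a ≤ log 2`) -/

/-- **`Re(W_∞(k) − W_2(k)) = (log 2/√2)·D_{log 2}(g) + ∫₀^∞ w D(g) − C₂‖g‖₂²`**, `k = g ⋆ g̃`, for a Weil test `g`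
supported in `[−a, a]` with `a ≤ log 2` (the tree's `{∞,2}` Markov decomposition `re_weilSemilocalQuadratic_two_eq`
minus the polar identity `Re(polar(g ⋆ g̃)) = P(g)`; `W_∞ = archW = weilArchTermBombieri = weilArchTerm` on Weil tests).
[folklore] -/
theorem re_semilocalSide_two_eq {g : ℝ → ℂ} {a : ℝ} (hg : IsWeilTest g) (hsupp : tsupport g ⊆ Icc (-a) a)
    (ha : a ≤ Real.log 2) :
    (archW (weilConv g (weilReflect g)) - weilSemilocalPrimeTerm {2} (weilConv g (weilReflect g))).re =
      Real.log 2 / Real.sqrt 2 * weilIncrement g (Real.log 2) +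
        (∫ t in Ioi (0 : ℝ), weilArchDensity t * weilIncrement g t) -
        semilocalTwoConstant * ∫ x : ℝ, ‖g x‖ ^ 2 := by
  have hk : IsWeilTest (weilConv g (weilReflect g)) := hg.weilConv hg.weilReflect
  have h := re_weilSemilocalQuadratic_two_eq hg hsupp ha
  unfold weilSemilocalQuadratic weilSemilocalFunctional at h
  rw [Complex.add_re, Complex.sub_re, weilPolarTerm_weilConv_weilReflect_re hg] at h
  have harch : archW (weilConv g (weilReflect g)) = weilArchTerm (weilConv g (weilReflect g)) :=
    weilArchTermBombieri_eq_weilArchTerm_holds hk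
  rw [Complex.sub_re, harch]
  linarith

/-- **The Weil side along the mollifications is eventually below any `C` exceeding the jump form of `G`.**
For `G` measurable, `|G| ≤ M`, `G = 0` off `[−b, b]` with `b < log 2`, continuous a.e., of finite archimedean
energy `∫₀^∞ w D(G) < ∞`: if `(log 2/√2)·D_{log 2}(G) + ∫₀^∞ w D(G) − C₂‖G‖₂² < C` then
`Re(W_∞ − W_2)(g_k ⋆ g̃_k) ≤ C` for all large `k`. [folklore] -/
theorem eventually_re_semilocalSide_two_moll_le (hGm : Measurable G) (hM : ∀ x, ‖G x‖ ≤ M)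
    (hGb : ∀ x, b < |x| → G x = 0) (hb2 : b < Real.log 2) (hGc : ∀ᵐ x : ℝ, ContinuousAt G x)
    (hfin : IntegrableOn (fun t ↦ weilArchDensity t * weilIncrement G t) (Ioi 0)) {C : ℝ}
    (hC : Real.log 2 / Real.sqrt 2 * weilIncrement G (Real.log 2) +
        (∫ t in Ioi (0 : ℝ), weilArchDensity t * weilIncrement G t) -
        semilocalTwoConstant * ∫ x : ℝ, ‖G x‖ ^ 2 < C) :
    ∀ᶠ k : ℕ in atTop,
      (archW (weilConv (weilConv G (moll k)) (weilReflect (weilConv G (moll k))))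
        - weilSemilocalPrimeTerm {2} (weilConv (weilConv G (moll k)) (weilReflect (weilConv G (moll k))))).re ≤ C := by
  set J : ℝ := Real.log 2 / Real.sqrt 2 * weilIncrement G (Real.log 2) +
    ∫ t in Ioi (0 : ℝ), weilArchDensity t * weilIncrement G t with hJ
  -- the support is eventually inside `[−log 2, log 2]`
  have e1 : ∀ᶠ k : ℕ in atTop, b + (bump k).rOut ≤ Real.log 2 := by
    have h : Tendsto (fun k : ℕ ↦ b + (bump k).rOut) atTop (𝓝 (b + 0)) := tendsto_bump_rOut.const_add b
    rw [add_zero] at h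
    exact h.eventually (Iic_mem_nhds hb2)
  -- `C₂‖g_k‖₂²` is eventually above `J − C`
  have e2 : ∀ᶠ k : ℕ in atTop, J - C < semilocalTwoConstant * ∫ x, ‖weilConv G (moll k) x‖ ^ 2 := by
    have hlim : Tendsto (fun k : ℕ ↦ semilocalTwoConstant * ∫ x, ‖weilConv G (moll k) x‖ ^ 2) atTop
        (𝓝 (semilocalTwoConstant * ∫ x, ‖G x‖ ^ 2)) :=
      (tendsto_integral_norm_sq_weilConv_moll_of_bdd hGm hM hGb hGc).const_mul _
    exact hlim.eventually (Ioi_mem_nhds (by linarith))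
  filter_upwards [e1, e2] with k hk1 hk2
  have hg := isWeilTest_weilConv_moll_of_bdd hGm hM hGb k
  have hsupp : tsupport (weilConv G (moll k)) ⊆ Icc (-(b + (bump k).rOut)) (b + (bump k).rOut) :=
    tsupport_weilConv_moll_subset_of_bdd hGb k
  rw [re_semilocalSide_two_eq hg hsupp hk1]
  have hD1 := weilIncrement_weilConv_moll_le_of_bdd hGm hM hGb k (Real.log 2)
  have hD2 : ∫ t in Ioi (0 : ℝ), weilArchDensity t * weilIncrement (weilConv G (moll k)) t ≤
      ∫ t in Ioi (0 : ℝ), weilArchDensity t * weilIncrement G t :=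
    setIntegral_mono_on (integrableOn_weilArchDensity_mul_weilIncrement hg) hfin measurableSet_Ioi
      (fun t ht ↦ mul_le_mul_of_nonneg_left (weilIncrement_weilConv_moll_le_of_bdd hGm hM hGb k t)
        (weilArchDensity_pos ht).le)
  have hc : 0 ≤ Real.log 2 / Real.sqrt 2 := by positivity
  have := mul_le_mul_of_nonneg_left hD1 hc
  linarith

/-! ## The final bridge at `S = {∞, 2}`: closed-form data only -/

/-- **Refutation of `SemilocalSoninIneqOn 2 a` from a bounded witness and a near-Sonin vector — closed-form data.**
`G` measurable, `|G| ≤ M`, `G = 0` off `[−b, b]`, `0 ≤ b < a`, `b < log 2`, continuous a.e., finite archimedean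
energy, CC's moment conditions `mulFourier G (I/2) = 0 = mulFourier G 0`; `η` a.e. even, vanishing a.e. on `[−1,1]`,
band-energy bound `Λ` (`hband`; the tree's constant is `9999428/10⁷`), `∫_{[−1,1]}|𝓕η|² ≤ ε`, `ε/(1 − Λ) ≤ d²`,
`0 ≤ d < ‖η‖`; reals `B ≤ Re⟨η|ϑ(T_2(G ⋆ G̃))η⟩`, `‖θ_2η‖² ≤ Gm`, `‖η‖ ≤ N`, `‖T_2(G⋆G̃)‖₁ < K`, and `0 ≤ C` with
`(log 2/√2)D_{log 2}(G) + ∫₀^∞ w D(G) − C₂‖G‖₂² < C`.  If `C·(Gm + 4(2N + d)d) < B − K(2N + d)d` then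
`¬ SemilocalSoninIneqOn 2 a`. [folklore] -/
theorem not_semilocalSoninIneqOn_two_of_bdd_witness {a : ℝ} (hGm : Measurable G) (hM : ∀ x, ‖G x‖ ≤ M)
    (hGb : ∀ x, b < |x| → G x = 0) (hb : 0 ≤ b) (hab : b < a) (hb2 : b < Real.log 2)
    (hGc : ∀ᵐ x : ℝ, ContinuousAt G x)
    (hfin : IntegrableOn (fun t ↦ weilArchDensity t * weilIncrement G t) (Ioi 0))
    (h1 : mulFourier G (I / 2) = 0) (h0 : mulFourier G 0 = 0)
    {η : Lp ℂ 2 (volume : Measure ℝ)} (hev : η ∈ evenPart) (hvan : η ∈ vanishOn 1)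
    {Λ : ℝ} (hΛ0 : 0 ≤ Λ) (hΛ1 : Λ < 1)
    (hband : ∀ f : Lp ℂ 2 (volume : Measure ℝ), (∀ᵐ x : ℝ, x ∉ Icc (-1 : ℝ) 1 → (f : ℝ → ℂ) x = 0) →
      ∫ x in Icc (-1 : ℝ) 1, ‖((𝓕 f : Lp ℂ 2 (volume : Measure ℝ)) : ℝ → ℂ) x‖ ^ 2 ≤ Λ * ‖f‖ ^ 2)
    {ε d B Gm N C K : ℝ}
    (hε : ∫ x in Icc (-1 : ℝ) 1, ‖((𝓕 η : Lp ℂ 2 (volume : Measure ℝ)) : ℝ → ℂ) x‖ ^ 2 ≤ ε)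
    (hdε : ε / (1 - Λ) ≤ d ^ 2) (hd0 : 0 ≤ d) (hdη : d < ‖η‖)
    (hB : B ≤ (soninTraceForm (twistKernel 2 (weilConv G (weilReflect G))) (η : ℝ → ℂ)).re)
    (hG : ‖primeTwist 2 η‖ ^ 2 ≤ Gm) (hN : ‖η‖ ≤ N)
    (hC : Real.log 2 / Real.sqrt 2 * weilIncrement G (Real.log 2) +
        (∫ t in Ioi (0 : ℝ), weilArchDensity t * weilIncrement G t) -
        semilocalTwoConstant * ∫ x : ℝ, ‖G x‖ ^ 2 < C) (hC0 : 0 ≤ C)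
    (hK : ∫ τ, ‖twistKernel 2 (weilConv G (weilReflect G)) τ‖ < K)
    (hineq : C * (Gm + 4 * ((2 * N + d) * d)) < B - K * ((2 * N + d) * d)) :
    ¬ SemilocalSoninIneqOn 2 a :=
  haveI : Fact (Nat.Prime 2) := ⟨Nat.prime_two⟩
  not_semilocalSoninIneqOn_of_bdd_witness_nearSonin 2 hGm hM hGb hb hab hGc h1 h0 hev hvan hΛ0 hΛ1 hband
    hε hdε hd0 hdη hB hG hN (eventually_re_semilocalSide_two_moll_le hGm hM hGb hb2 hGc hfin hC) hC0 hK hineq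

end BoundedWitnessWeil

end Summit.RiemannHypothesis.RiemannHypothesis
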